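import Literature.Combinatorics.Optimization.PerfectMatchingPolytopeGluing
import Mathlib.Analysis.Convex.Birkhoff
import Mathlib.Analysis.Convex.KreinMilman
import Mathlib.GroupTheory.Perm.Cycle.Factors
import Mathlib.Topology.Order.Compact
import Mathlib.Topology.MetricSpace.Basic
import Mathlib.Algebra.Ring.Commute
import HarnessLib

/-!
# Edmonds' perfect matching polytope theorem, II: vertices, and the theorem (PROVED)

J. Edmonds, *Maximum matching and a polyhedron with 0,1-vertices*, J. Res. Nat. Bur. Standards **69B**
(1965) 125–130 [Edmonds1965], §2 Theorem (P) (p. 126, matching form); perfect-matching form: B. Korte, J. Vygen, *Combinatorial Optimization* (6th ed., 2018)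
[KorteVygen2018], Thm. 11.15 (p. 297): the perfect matching polytope is described by nonnegativity, the
degree equations and the odd-cut inequalities `x(δ(A)) ≥ 1` (`|A|` odd).

Main result: `IsOddCutPoint.isPMConv` — **every point of Edmonds' description is a convex combination of
perfect matchings** (complete graph on any finite vertex type `W`, arbitrary real edge weights, in the
symmetric-function form of `PerfectMatchingPolytopeGluing.lean`; the converse inclusion is the easy
`IsPMConv.isOddCutPoint`). The graph form (weights supported on `E(G)`) and the matching polytope are
derived in `EdmondsMatchingPolytope.lean`.

Proof (the classical induction on `|V|` over a tight odd cut — Schrijver's proof, [Schrijver2003]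
Thm. 25.1 — with the vertex analysis done through Birkhoff–von Neumann instead of counting tight
constraints; all steps are proved here or in the gluing file):
1. (`direction_eq_zero`) at an EXTREME point `x` at which every nontrivial odd cut is strict, any
   symmetric zero-diagonal direction `d` supported on `supp x` with zero row sums vanishes (else
   `x ± εd` stay in the polytope — an open-set argument gives `ε`).
2. (`exists_isPM_eq_pmInd_of_extreme`) such an `x` IS a perfect matching: as a doubly stochastic matrix
   it dominates a positive multiple of a permutation matrix `P_π` (Mathlib's
   `exists_eq_sum_perm_of_mem_doublyStochastic`), step 1 with `d = S_π − S_ρ` (`S_π = (P_π + P_πᵀ)/2`)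
   forces `x = S_π`; a cycle of `π` of odd length `≥ 3` would be an odd set with cut value `0`, one of
   even length `≥ 4` carries the alternating direction `± 1` (signs `(−1)^k` along the cycle, bookkept with
   `Equiv.Perm.IsCycleOn.pow_apply_eq_pow_apply`), contradicting step 1; so `π` is a fixed-point-free
   involution and `x = P_π`.
3. (`IsOddCutPoint.isPMConv`, strong induction on `|W|`) an extreme point with a TIGHT odd cut `U`,
   `3 ≤ |U| ≤ |W| − 3`, is handled by contracting `U` and `W ∖ U` (`IsOddCutPoint.contract`), the
   induction hypothesis on both smaller instances, and `isPMConv_of_contract` (product gluing); finally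
   the polytope is compact and convex and the set of convex combinations of perfect matchings is closed
   and convex, so Minkowski/Krein–Milman (`closure_convexHull_extremePoints`) concludes.
-/

noncomputable section

open Finset

namespace Literature.Combinatorics.Optimization

namespace PerfectMatchingPolytope

open _root_.Topology

universe u

variable {W : Type*} [Fintype W] [DecidableEq W]

/-! ## The easy inclusion -/

/-- For a perfect matching `σ` and any set `U`, the cut `χ^σ(δ(U))` counts the vertices of `U` matched
outside `U`; if `|U|` is odd there is at least one. [cite: KorteVygen2018, Thm. 11.15 (p. 297)] -/
theorem IsPM.one_le_cut {σ : W → W} (hσ : IsPM σ) (U : Finset W) (hU : Odd U.card) :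
    1 ≤ cut (pmInd σ) U := by
  classical
  -- if every vertex of `U` were matched inside `U`, `σ` would be a fixed-point-free involution of `U`
  by_contra hlt
  push Not at hlt
  have hzero : ∀ v ∈ U, σ v ∈ U := by
    intro v hv
    by_contra hout
    have h1 : (1 : ℝ) ≤ cut (pmInd σ) U := by
      unfold cut
      have hv1 : (1 : ℝ) ≤ ∑ u ∈ Uᶜ, pmInd σ v u := by
        have : pmInd σ v (σ v) = 1 := by simp [pmInd]
        rw [← this]
        exact Finset.single_le_sum (f := fun u => pmInd σ v u) (fun u _ => pmInd_nonneg σ v u)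
          (Finset.mem_compl.mpr hout)
      exact hv1.trans (Finset.single_le_sum (f := fun w => ∑ u ∈ Uᶜ, pmInd σ w u)
        (fun w _ => Finset.sum_nonneg fun u _ => pmInd_nonneg σ w u) hv)
    linarith
  -- `σ` restricted to `U` is a fixed-point-free involution, so `|U|` is even
  have heven : Even U.card := by
    -- pair `v` with `σ v`: the map is an involution of `U` without fixed points
    have key : ∀ s : Finset W, (∀ v ∈ s, σ v ∈ s) → Even s.card := by
      intro s
      induction s using Finset.strongInduction with
      | H s ih =>
        intro hs
        rcases s.eq_empty_or_nonempty with hse | ⟨v, hv⟩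
        · simp [hse]
        · have hσv : σ v ∈ s := hs v hv
          have hne : σ v ≠ v := (hσ v).1
          set s' := (s.erase v).erase (σ v) with hs'
          have hsub : s' ⊂ s := by
            refine Finset.ssubset_iff_subset_ne.mpr ⟨fun w hw => ?_, fun h => ?_⟩
            · exact Finset.mem_of_mem_erase (Finset.mem_of_mem_erase hw)
            · have : v ∈ s' := h ▸ hv
              simp [s'] at this
          have hcl : ∀ w ∈ s', σ w ∈ s' := by
            intro w hw
            have hw1 : w ≠ σ v := (Finset.mem_erase.mp hw).1
            have hw2 : w ≠ v := (Finset.mem_erase.mp (Finset.mem_erase.mp hw).2).1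
            have hw3 : w ∈ s := Finset.mem_of_mem_erase (Finset.mem_of_mem_erase hw)
            refine Finset.mem_erase.mpr ⟨fun h => hw2 ?_, Finset.mem_erase.mpr ⟨fun h => hw1 ?_, hs w hw3⟩⟩
            · have := congrArg σ h
              rwa [(hσ w).2, (hσ v).2] at this
            · rw [← h, (hσ w).2]
          have hcard : s.card = s'.card + 2 := by
            have h1 : (s.erase v).card + 1 = s.card := Finset.card_erase_add_one hv
            have h2 : σ v ∈ s.erase v := Finset.mem_erase.mpr ⟨hne, hσv⟩
            have h3 : ((s.erase v).erase (σ v)).card + 1 = (s.erase v).card :=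
              Finset.card_erase_add_one h2
            show s.card = ((s.erase v).erase (σ v)).card + 2
            omega
          rw [hcard]
          exact (ih s' hsub hcl).add (by decide)
    exact key U hzero
  exact (Nat.not_even_iff_odd.mpr hU) heven

/-- **The easy half of Edmonds' theorem**: a convex combination of perfect matchings satisfies Edmonds'
description. [cite: KorteVygen2018, Thm. 11.15 (p. 297)] -/
theorem IsPMConv.isOddCutPoint {x : W → W → ℝ} (hx : IsPMConv x) : IsOddCutPoint x := by
  obtain ⟨wt, hw, hs, hsum, hrep⟩ := hx
  -- every term with nonzero weight is a perfect matching
  have hterm : ∀ σ, ∀ P : (W → W) → Prop, (IsPM σ → P σ) → wt σ ≠ 0 → P σ :=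
    fun σ P h hσ => h (hs σ hσ)
  refine ⟨?_, ?_, ?_, ?_, ?_⟩
  · intro u v
    rw [hrep, hrep]
    refine Finset.sum_congr rfl fun σ _ => ?_
    by_cases h : wt σ = 0
    · simp [h]
    · rw [(hs σ h).pmInd_symm]
  · intro v
    rw [hrep]
    refine Finset.sum_eq_zero fun σ _ => ?_
    by_cases h : wt σ = 0
    · simp [h]
    · rw [(hs σ h).pmInd_diag, mul_zero]
  · intro u v
    rw [hrep]
    exact Finset.sum_nonneg fun σ _ => mul_nonneg (hw σ) (pmInd_nonneg σ u v)
  · intro v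
    simp_rw [hrep]
    rw [Finset.sum_comm]
    simp_rw [← Finset.mul_sum, sum_pmInd, mul_one]
    exact hsum
  · intro U hU
    have hcut : cut x U = ∑ σ, wt σ * cut (pmInd σ) U := by
      unfold cut
      calc ∑ v ∈ U, ∑ u ∈ Uᶜ, x v u = ∑ v ∈ U, ∑ u ∈ Uᶜ, ∑ σ, wt σ * pmInd σ v u := by
            simp_rw [← hrep]
        _ = ∑ v ∈ U, ∑ σ, ∑ u ∈ Uᶜ, wt σ * pmInd σ v u :=
            Finset.sum_congr rfl fun v _ => Finset.sum_comm
        _ = ∑ σ, ∑ v ∈ U, ∑ u ∈ Uᶜ, wt σ * pmInd σ v u := Finset.sum_comm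
        _ = ∑ σ, wt σ * ∑ v ∈ U, ∑ u ∈ Uᶜ, pmInd σ v u := by simp_rw [Finset.mul_sum]
    rw [hcut]
    calc (1 : ℝ) = ∑ σ, wt σ * 1 := by rw [← Finset.sum_mul, hsum, one_mul]
      _ ≤ ∑ σ, wt σ * cut (pmInd σ) U := by
        refine Finset.sum_le_sum fun σ _ => ?_
        by_cases h : wt σ = 0
        · simp [h]
        · exact mul_le_mul_of_nonneg_left ((hs σ h).one_le_cut U hU) (hw σ)

/-! ## Step 1: feasible directions at an extreme point -/

/-- Cuts are linear. [cite: KorteVygen2018, Thm. 11.15 (p. 297)] -/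
theorem cut_add_smul (x d : W → W → ℝ) (t : ℝ) (U : Finset W) :
    cut (x + t • d) U = cut x U + t * cut d U := by
  unfold cut
  simp only [Pi.add_apply, Pi.smul_apply, smul_eq_mul, Finset.sum_add_distrib, Finset.mul_sum]

/-- An odd set all of whose nontrivial versions are excluded is a singleton or a co-singleton, where the
cut is a row sum: for `y` symmetric with zero diagonal and unit row sums, `cut y U = 1` whenever `|U|` is
odd and `|U| < 3` or `|Uᶜ| < 3` (on an even vertex set). [cite: KorteVygen2018, Thm. 11.15 (p. 297)] -/
theorem cut_eq_one_of_trivial {y : W → W → ℝ} (hs : ∀ u v, y u v = y v u) (hd : ∀ v, y v v = 0)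
    (hrow : ∀ v, ∑ u, y v u = 1) (heven : Even (Fintype.card W)) {U : Finset W} (hU : Odd U.card)
    (hsmall : U.card < 3 ∨ Uᶜ.card < 3) : cut y U = 1 := by
  have hUc : Odd Uᶜ.card := by
    rw [Finset.card_compl]
    have hle : U.card ≤ Fintype.card W := Finset.card_le_univ U
    rcases heven with ⟨k, hk⟩
    rcases hU with ⟨l, hl⟩
    exact ⟨k - l - 1, by omega⟩
  have single : ∀ V : Finset W, V.card = 1 → cut y V = 1 := by
    intro V hV
    obtain ⟨v, rfl⟩ := Finset.card_eq_one.mp hV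
    rw [cut_singleton, hrow, hd, sub_zero]
  rcases hsmall with h | h
  · have h1 : U.card = 1 := by
      rcases hU with ⟨l, hl⟩; omega
    exact single U h1
  · have h1 : Uᶜ.card = 1 := by
      rcases hUc with ⟨l, hl⟩; omega
    rw [← cut_compl hs, single Uᶜ h1]

/-- **Step 1.** At an extreme point `x` of Edmonds' description at which every nontrivial odd cut
(`3 ≤ |U|`, `3 ≤ |Uᶜ|`) is strict, every symmetric zero-diagonal direction `d` supported on the support
of `x` and with zero row sums is `0` (otherwise `x ± εd` lie in the polytope for small `ε > 0`).
[cite: KorteVygen2018, Thm. 11.15 (p. 297)] -/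
theorem direction_eq_zero {x : W → W → ℝ} (hext : x ∈ (oddCutPolytope W).extremePoints ℝ)
    (hstrict : ∀ U : Finset W, Odd U.card → 3 ≤ U.card → 3 ≤ Uᶜ.card → 1 < cut x U)
    {d : W → W → ℝ} (hds : ∀ u v, d u v = d v u) (hdd : ∀ v, d v v = 0)
    (hsupp : ∀ u v, x u v = 0 → d u v = 0) (hdrow : ∀ v, ∑ u, d v u = 0) : d = 0 := by
  rw [mem_extremePoints] at hext
  obtain ⟨hxQ, hext⟩ := hext
  have hx : IsOddCutPoint x := hxQ
  -- the set of good parameters is open and contains `0`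
  set T : Set ℝ := {t | (∀ u v : W, 0 < x u v → 0 < x u v + t * d u v) ∧
    ∀ U : Finset W, Odd U.card → 3 ≤ U.card → 3 ≤ Uᶜ.card → 1 < cut x U + t * cut d U} with hT
  have hopen : IsOpen T := by
    have e : T = (⋂ u : W, ⋂ v : W, {t : ℝ | 0 < x u v → 0 < x u v + t * d u v}) ∩
        ⋂ U : Finset W, {t : ℝ | Odd U.card → 3 ≤ U.card → 3 ≤ Uᶜ.card →
          1 < cut x U + t * cut d U} := by
      ext t; simp [T]
    rw [e]
    refine IsOpen.inter (isOpen_iInter_of_finite fun u => isOpen_iInter_of_finite fun v => ?_)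
      (isOpen_iInter_of_finite fun U => ?_)
    · by_cases h : 0 < x u v
      · have : {t : ℝ | 0 < x u v → 0 < x u v + t * d u v} = {t | 0 < x u v + t * d u v} := by
          ext t; simp [h]
        rw [this]
        exact isOpen_lt continuous_const (by fun_prop)
      · have : {t : ℝ | 0 < x u v → 0 < x u v + t * d u v} = Set.univ := by
          ext t; simp [h]
        rw [this]; exact isOpen_univ
    · by_cases h : Odd U.card ∧ 3 ≤ U.card ∧ 3 ≤ Uᶜ.card
      · have : {t : ℝ | Odd U.card → 3 ≤ U.card → 3 ≤ Uᶜ.card → 1 < cut x U + t * cut d U} =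
            {t | 1 < cut x U + t * cut d U} := by
          ext t; simp only [Set.mem_setOf_eq]; tauto
        rw [this]
        exact isOpen_lt continuous_const (by fun_prop)
      · have : {t : ℝ | Odd U.card → 3 ≤ U.card → 3 ≤ Uᶜ.card → 1 < cut x U + t * cut d U} =
            Set.univ := by
          ext t; simp only [Set.mem_setOf_eq, Set.mem_univ, iff_true]; tauto
        rw [this]; exact isOpen_univ
  have h0 : (0 : ℝ) ∈ T := by
    refine ⟨fun u v h => by simpa using h, fun U hU h3 h3c => by simpa using hstrict U hU h3 h3c⟩
  obtain ⟨ε, hε, hball⟩ := Metric.isOpen_iff.mp hopen 0 h0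
  -- every good parameter gives a point of the polytope
  have hmem : ∀ t ∈ T, x + t • d ∈ oddCutPolytope W := by
    intro t ht
    obtain ⟨ht1, ht2⟩ := ht
    refine ⟨fun u v => ?_, fun v => ?_, fun u v => ?_, fun v => ?_, fun U hU => ?_⟩
    · simp only [Pi.add_apply, Pi.smul_apply, smul_eq_mul]; rw [hx.symm u v, hds u v]
    · simp only [Pi.add_apply, Pi.smul_apply, smul_eq_mul]; rw [hx.diag, hdd]; ring
    · simp only [Pi.add_apply, Pi.smul_apply, smul_eq_mul]
      by_cases h : x u v = 0
      · rw [h, hsupp u v h]; simp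
      · exact (ht1 u v (lt_of_le_of_ne (hx.nonneg u v) (Ne.symm h))).le
    · simp only [Pi.add_apply, Pi.smul_apply, smul_eq_mul, Finset.sum_add_distrib, ← Finset.mul_sum]
      rw [hx.row, hdrow]; ring
    · rw [cut_add_smul]
      by_cases h : 3 ≤ U.card ∧ 3 ≤ Uᶜ.card
      · exact (ht2 U hU h.1 h.2).le
      · have hsmall : U.card < 3 ∨ Uᶜ.card < 3 := by omega
        have e := cut_eq_one_of_trivial (y := x + t • d)
          (fun u v => by simp only [Pi.add_apply, Pi.smul_apply, smul_eq_mul]; rw [hx.symm u v, hds u v])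
          (fun v => by simp only [Pi.add_apply, Pi.smul_apply, smul_eq_mul]; rw [hx.diag, hdd]; ring)
          (fun v => by
            simp only [Pi.add_apply, Pi.smul_apply, smul_eq_mul, Finset.sum_add_distrib,
              ← Finset.mul_sum]
            rw [hx.row, hdrow]; ring)
          hx.even_card hU hsmall
        rw [cut_add_smul] at e
        exact e.symm.le
  -- `x ± (ε/2) d` are in the polytope and `x` is their midpoint
  have hplus : x + (ε / 2) • d ∈ oddCutPolytope W :=
    hmem _ (hball (by rw [Metric.mem_ball, Real.dist_eq, sub_zero, abs_of_pos (by linarith)]; linarith))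
  have hminus : x + (-(ε / 2)) • d ∈ oddCutPolytope W :=
    hmem _ (hball (by rw [Metric.mem_ball, Real.dist_eq, sub_zero, abs_of_neg (by linarith)]; linarith))
  have hseg : x ∈ openSegment ℝ (x + (ε / 2) • d) (x + (-(ε / 2)) • d) := by
    refine ⟨1 / 2, 1 / 2, by norm_num, by norm_num, by norm_num, ?_⟩
    ext u v
    simp only [Pi.add_apply, Pi.smul_apply, smul_eq_mul]
    ring
  have h := (hext _ hplus _ hminus hseg).1
  have h2 : (ε / 2) • d = 0 := by
    have : x + (ε / 2) • d = x + 0 := by rw [add_zero]; exact h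
    exact add_left_cancel this
  rcases smul_eq_zero.mp h2 with h3 | h3
  · exact absurd h3 (by linarith)
  · exact h3

/-! ## Step 2: an extreme point without tight nontrivial odd cuts is a perfect matching -/

/-- **Birkhoff step**: a point of Edmonds' description dominates a positive multiple of a permutation
matrix: there is a permutation `π` with `x(u, πu) > 0` for all `u` (Mathlib's Birkhoff–von Neumann
theorem `exists_eq_sum_perm_of_mem_doublyStochastic`), and moreover `x = Σ_ρ w_ρ P_ρ` with all `ρ` of
positive weight so supported. [cite: KorteVygen2018, Thm. 11.15 (p. 297)] -/
theorem IsOddCutPoint.exists_perm_decomposition {x : W → W → ℝ} (hx : IsOddCutPoint x) :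
    ∃ w : Equiv.Perm W → ℝ, (∀ ρ, 0 ≤ w ρ) ∧ ∑ ρ, w ρ = 1 ∧
      (∀ u v, x u v = ∑ ρ, w ρ * pmInd ρ u v) ∧
      ∀ ρ, w ρ ≠ 0 → ∀ u, 0 < x u (ρ u) := by
  have hM : (Matrix.of fun u v => x u v) ∈ doublyStochastic ℝ W := by
    rw [mem_doublyStochastic_iff_sum]
    refine ⟨fun u v => hx.nonneg u v, fun u => hx.row u, fun v => ?_⟩
    simp only [Matrix.of_apply]
    rw [show ∑ u, x u v = ∑ u, x v u from Finset.sum_congr rfl fun u _ => hx.symm u v]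
    exact hx.row v
  obtain ⟨w, hw0, hw1, hwM⟩ := exists_eq_sum_perm_of_mem_doublyStochastic hM
  have hrep : ∀ u v, x u v = ∑ ρ, w ρ * pmInd ρ u v := by
    intro u v
    have h := congrFun (congrFun hwM u) v
    simp only [Matrix.of_apply] at h
    rw [← h, Matrix.sum_apply]
    refine Finset.sum_congr rfl fun ρ _ => ?_
    rw [Matrix.smul_apply, permMatrix_apply', smul_eq_mul]
  refine ⟨w, hw0, hw1, hrep, fun ρ hρ u => ?_⟩
  rw [hrep]
  have hpos : 0 < w ρ := lt_of_le_of_ne (hw0 ρ) (Ne.symm hρ)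
  calc (0 : ℝ) < w ρ * pmInd ρ u (ρ u) := by simp [pmInd, hpos]
    _ ≤ ∑ ρ', w ρ' * pmInd ρ' u (ρ u) :=
      Finset.single_le_sum (f := fun ρ' => w ρ' * pmInd ρ' u (ρ u))
        (fun ρ' _ => mul_nonneg (hw0 ρ') (pmInd_nonneg _ _ _)) (Finset.mem_univ ρ)

/-- For two permutations supported on the support of an extreme point without tight nontrivial odd
cuts, the symmetrizations agree: `S_π = S_ρ` (Step 1 with `d = S_π − S_ρ`). [cite: KorteVygen2018, Thm. 11.15 (p. 297)] -/
theorem symPerm_eq_of_extreme {x : W → W → ℝ} (hext : x ∈ (oddCutPolytope W).extremePoints ℝ)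
    (hstrict : ∀ U : Finset W, Odd U.card → 3 ≤ U.card → 3 ≤ Uᶜ.card → 1 < cut x U)
    {π ρ : Equiv.Perm W} (hπ : ∀ u, 0 < x u (π u)) (hρ : ∀ u, 0 < x u (ρ u)) :
    symPerm π = symPerm ρ := by
  have hx : IsOddCutPoint x := hext.1
  -- supports
  have hfp : ∀ (τ : Equiv.Perm W), (∀ u, 0 < x u (τ u)) → ∀ u v, x u v = 0 → symPerm τ u v = 0 := by
    intro τ hτ u v h0
    unfold symPerm pmInd
    have h1 : τ u ≠ v := fun h => by have := hτ u; rw [h, h0] at this; exact lt_irrefl _ this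
    have h2 : τ v ≠ u := fun h => by
      have := hτ v; rw [h, hx.symm, h0] at this; exact lt_irrefl _ this
    simp [h1, h2]
  have hdiag : ∀ (τ : Equiv.Perm W), (∀ u, 0 < x u (τ u)) → ∀ v, symPerm τ v v = 0 := by
    intro τ hτ v
    exact hfp τ hτ v v (hx.diag v)
  have h := direction_eq_zero hext hstrict (d := symPerm π - symPerm ρ)
    (fun u v => by simp only [Pi.sub_apply, symPerm]; ring)
    (fun v => by simp only [Pi.sub_apply]; rw [hdiag π hπ, hdiag ρ hρ, sub_zero])
    (fun u v h0 => by simp only [Pi.sub_apply]; rw [hfp π hπ u v h0, hfp ρ hρ u v h0, sub_zero])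
    (fun v => by simp only [Pi.sub_apply, Finset.sum_sub_distrib, sum_symPerm, sub_self])
  exact sub_eq_zero.mp h

/-- Hence such an extreme point IS the symmetrization `S_π` of any permutation in its Birkhoff support.
[cite: KorteVygen2018, Thm. 11.15 (p. 297)] -/
theorem eq_symPerm_of_extreme {x : W → W → ℝ} (hext : x ∈ (oddCutPolytope W).extremePoints ℝ)
    (hstrict : ∀ U : Finset W, Odd U.card → 3 ≤ U.card → 3 ≤ Uᶜ.card → 1 < cut x U)
    {w : Equiv.Perm W → ℝ} (hw1 : ∑ ρ, w ρ = 1)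
    (hrep : ∀ u v, x u v = ∑ ρ, w ρ * pmInd ρ u v) (hsupp : ∀ ρ, w ρ ≠ 0 → ∀ u, 0 < x u (ρ u))
    {π : Equiv.Perm W} (hπ : ∀ u, 0 < x u (π u)) : x = symPerm π := by
  have hx : IsOddCutPoint x := hext.1
  funext u v
  have h1 : x u v = ∑ ρ, w ρ * symPerm ρ u v := by
    have e1 := hrep u v
    have e2 := hrep v u
    rw [← hx.symm u v] at e2
    have e3 : ∀ ρ, w ρ * symPerm ρ u v = (w ρ * pmInd ρ u v + w ρ * pmInd ρ v u) / 2 :=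
      fun ρ => by unfold symPerm; ring
    simp_rw [e3]
    rw [← Finset.sum_div, Finset.sum_add_distrib, ← e1, ← e2]; ring
  rw [h1]
  have h2 : ∀ ρ, w ρ * symPerm ρ u v = w ρ * symPerm π u v := by
    intro ρ
    by_cases h : w ρ = 0
    · simp [h]
    · rw [symPerm_eq_of_extreme hext hstrict (hsupp ρ h) hπ]
  simp_rw [h2]
  rw [← Finset.sum_mul, hw1, one_mul]

/-- **Step 2.** An extreme point of Edmonds' description at which every nontrivial odd cut is strict
is (the incidence matrix of) a perfect matching. [cite: KorteVygen2018, Thm. 11.15 (p. 297)] -/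
theorem exists_isPM_eq_pmInd_of_extreme {x : W → W → ℝ}
    (hext : x ∈ (oddCutPolytope W).extremePoints ℝ)
    (hstrict : ∀ U : Finset W, Odd U.card → 3 ≤ U.card → 3 ≤ Uᶜ.card → 1 < cut x U) :
    ∃ σ : W → W, IsPM σ ∧ x = pmInd σ := by
  classical
  have hx : IsOddCutPoint x := hext.1
  obtain ⟨w, hw0, hw1, hrep, hsupp⟩ := hx.exists_perm_decomposition
  -- a permutation in the Birkhoff support
  obtain ⟨π, -, hπ0⟩ : ∃ π ∈ (Finset.univ : Finset (Equiv.Perm W)), w π ≠ 0 :=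
    Finset.exists_ne_zero_of_sum_ne_zero (by rw [hw1]; exact one_ne_zero)
  have hπ : ∀ u, 0 < x u (π u) := hsupp π hπ0
  have hfp : ∀ u, π u ≠ u := fun u h => by
    have := hπ u; rw [h, hx.diag] at this; exact lt_irrefl _ this
  have hxS : x = symPerm π := eq_symPerm_of_extreme hext hstrict hw1 hrep hsupp hπ
  -- `π` is an involution
  have hinv : ∀ v, π (π v) = v := by
    intro v
    by_contra hv2
    -- the cycle of `π` through `v`
    set C : Finset W := (π.cycleOf v).support with hC
    have hcyc : π.IsCycleOn C := Equiv.Perm.isCycleOn_support_cycleOf π v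
    have hvC : v ∈ C := by
      rw [hC, Equiv.Perm.mem_support_cycleOf_iff]
      exact ⟨Equiv.Perm.SameCycle.refl π v, Equiv.Perm.mem_support.mpr (hfp v)⟩
    have hmemC : ∀ u, u ∈ C → π u ∈ C := fun u hu => hcyc.apply_mem_iff.mpr hu
    have hmemC' : ∀ u, π u ∈ C → u ∈ C := fun u hu => hcyc.apply_mem_iff.mp hu
    have hinvC : ∀ u, u ∈ C → π.symm u ∈ C := fun u hu => hmemC' _ (by simpa using hu)
    have h2le : 2 ≤ C.card := by
      rw [hC, Equiv.Perm.two_le_card_support_cycleOf_iff]; exact hfp v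
    have hne2 : C.card ≠ 2 := by
      intro h2
      have := hcyc.pow_card_apply hvC
      rw [h2, pow_two, Equiv.Perm.mul_apply] at this
      exact hv2 this
    have h3 : 3 ≤ C.card := by omega
    -- no square returns on `C`
    have hsq : ∀ u, u ∈ C → π (π u) ≠ u := by
      intro u hu h
      have h' : (π ^ 2) u = u := by rw [pow_two, Equiv.Perm.mul_apply]; exact h
      rw [hcyc.pow_apply_eq hu] at h'
      have := Nat.le_of_dvd two_pos h'
      omega
    rcases Nat.even_or_odd C.card with heven | hodd
    · -- even cycle: the alternating direction
      have hex : ∀ u, u ∈ C → ∃ n : ℕ, (π ^ n) v = u := fun u hu => by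
        obtain ⟨n, -, hn⟩ := hcyc.exists_pow_eq hvC hu
        exact ⟨n, hn⟩
      let k : W → ℕ := fun u => if h : u ∈ C then Nat.find (hex u h) else 0
      have hk : ∀ u (h : u ∈ C), (π ^ k u) v = u := by
        intro u h
        simp only [k, dif_pos h]
        exact Nat.find_spec (hex u h)
      let sgn : W → ℝ := fun u => if u ∈ C then (-1) ^ (k u) else 0
      have hsgn : ∀ u, u ∈ C → sgn (π u) = -sgn u := by
        intro u hu
        have hπu : π u ∈ C := hmemC u hu
        simp only [sgn, if_pos hu, if_pos hπu]
        -- `k (π u) ≡ k u + 1 (mod |C|)`, and `|C|` is even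
        have e1 : (π ^ k (π u)) v = (π ^ (k u + 1)) v := by
          rw [hk (π u) hπu, pow_succ', Equiv.Perm.mul_apply, hk u hu]
        rw [hcyc.pow_apply_eq_pow_apply hvC] at e1
        have e2 : k (π u) % 2 = (k u + 1) % 2 := by
          have := (Nat.ModEq.of_dvd (even_iff_two_dvd.mp heven) e1)
          exact this
        rw [neg_one_pow_eq_pow_mod_two (R := ℝ) (k (π u)), e2, ← neg_one_pow_eq_pow_mod_two,
          pow_succ]
        ring
      let d : W → W → ℝ := fun u w => sgn u * pmInd π u w + sgn w * pmInd π w u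
      have hsgn0 : ∀ u, u ∉ C → sgn u = 0 := fun u hu => by simp only [sgn, if_neg hu]
      have hd : d = 0 := by
        refine direction_eq_zero hext hstrict (d := d) (fun u w => by simp only [d]; ring)
          (fun u => ?_) (fun u w h0 => ?_) (fun u => ?_)
        · simp only [d, pmInd, if_neg (hfp u)]; ring
        · have h1 : π u ≠ w := fun h => by
            have := hπ u; rw [h, h0] at this; exact lt_irrefl _ this
          have h2 : π w ≠ u := fun h => by
            have := hπ w; rw [h, hx.symm, h0] at this; exact lt_irrefl _ this
          simp only [d, pmInd, if_neg h1, if_neg h2]; ring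
        · -- row sum: `sgn u + sgn (π⁻¹ u)`
          simp only [d, Finset.sum_add_distrib, ← Finset.mul_sum, sum_pmInd, mul_one]
          have e : ∑ w, sgn w * pmInd (⇑π) w u = sgn (π.symm u) := by
            unfold pmInd
            have : ∀ w, (π w = u) = (w = π.symm u) := fun w => propext π.apply_eq_iff_eq_symm_apply
            simp_rw [this]
            simp
          rw [e]
          by_cases hu : u ∈ C
          · have h1 := hsgn (π.symm u) (hinvC u hu)
            rw [Equiv.apply_symm_apply] at h1
            rw [h1]; ring
          · have h1 : π.symm u ∉ C := fun h => hu (by simpa using hmemC _ h)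
            rw [hsgn0 u hu, hsgn0 _ h1]; ring
      -- but `d v (π v) = sgn v = 1`
      have hkv : k v = 0 := by
        simp only [k, dif_pos hvC]
        rw [Nat.find_eq_zero]
        simp
      have hdv : d v (π v) = 1 := by
        simp only [d, pmInd, if_neg (hsq v hvC), sgn, if_pos hvC, hkv]
        norm_num
      rw [hd] at hdv
      simp at hdv
    · -- odd cycle: an odd set with zero cut
      have h1 := hx.oddCut C hodd
      have h0 : cut x C = 0 := by
        rw [hxS]
        unfold cut
        refine Finset.sum_eq_zero fun u hu => Finset.sum_eq_zero fun w hw => ?_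
        rw [Finset.mem_compl] at hw
        have e1 : π u ≠ w := fun h => hw (h ▸ hmemC u hu)
        have e2 : π w ≠ u := fun h => hw (hmemC' w (h ▸ hu))
        simp [symPerm, pmInd, e1, e2]
      linarith
  have hPM : IsPM (⇑π) := fun v => ⟨hfp v, hinv v⟩
  refine ⟨π, hPM, ?_⟩
  rw [hxS]
  funext u v
  unfold symPerm
  rw [hPM.pmInd_symm v u]; ring

/-! ## Step 3: compactness, closedness, and the induction -/

/-- Edmonds' description is a compact set. [cite: KorteVygen2018, Thm. 11.15 (p. 297)] -/
theorem isCompact_oddCutPolytope : IsCompact (oddCutPolytope W) := by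
  -- closed subset of the cube `[0,1]^{W×W}`
  have hsub : oddCutPolytope W ⊆ Set.Icc 0 1 := by
    intro x hx
    exact ⟨fun u v => hx.nonneg u v, fun u v => hx.le_one u v⟩
  refine (isCompact_Icc.of_isClosed_subset ?_ hsub)
  have e : oddCutPolytope W = (⋂ u : W, ⋂ v : W, {x : W → W → ℝ | x u v = x v u}) ∩
      (⋂ v : W, {x : W → W → ℝ | x v v = 0}) ∩ (⋂ u : W, ⋂ v : W, {x : W → W → ℝ | 0 ≤ x u v}) ∩
      (⋂ v : W, {x : W → W → ℝ | ∑ u, x v u = 1}) ∩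
      ⋂ U : Finset W, {x : W → W → ℝ | Odd U.card → 1 ≤ cut x U} := by
    ext x
    simp only [oddCutPolytope, Set.mem_setOf_eq, Set.mem_inter_iff, Set.mem_iInter]
    exact ⟨fun h => ⟨⟨⟨⟨h.symm, h.diag⟩, h.nonneg⟩, h.row⟩, h.oddCut⟩,
      fun ⟨⟨⟨⟨h1, h2⟩, h3⟩, h4⟩, h5⟩ => ⟨h1, h2, h3, h4, h5⟩⟩
  rw [e]
  have hev : ∀ u v : W, Continuous fun x : W → W → ℝ => x u v := fun u v =>
    (continuous_apply v).comp (continuous_apply u)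
  have hcut : ∀ U : Finset W, Continuous fun x : W → W → ℝ => cut x U := fun U => by
    unfold cut; fun_prop
  refine IsClosed.inter (IsClosed.inter (IsClosed.inter (IsClosed.inter ?_ ?_) ?_) ?_) ?_
  · exact isClosed_iInter fun u => isClosed_iInter fun v => isClosed_eq (hev u v) (hev v u)
  · exact isClosed_iInter fun v => isClosed_eq (hev v v) continuous_const
  · exact isClosed_iInter fun u => isClosed_iInter fun v => isClosed_le continuous_const (hev u v)
  · exact isClosed_iInter fun v => isClosed_eq (by fun_prop) continuous_const
  · refine isClosed_iInter fun U => ?_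
    by_cases h : Odd U.card
    · have : {x : W → W → ℝ | Odd U.card → 1 ≤ cut x U} = {x | 1 ≤ cut x U} := by
        ext x; simp [h]
      rw [this]; exact isClosed_le continuous_const (hcut U)
    · have : {x : W → W → ℝ | Odd U.card → 1 ≤ cut x U} = Set.univ := by
        ext x; simp [h]
      rw [this]; exact isClosed_univ

/-- Edmonds' description is convex. [cite: KorteVygen2018, Thm. 11.15 (p. 297)] -/
theorem convex_oddCutPolytope : Convex ℝ (oddCutPolytope W) := by
  intro x hx y hy a b ha hb hab
  have hxy : ∀ u v, (a • x + b • y) u v = a * x u v + b * y u v := fun u v => by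
    simp only [Pi.add_apply, Pi.smul_apply, smul_eq_mul]
  refine ⟨fun u v => ?_, fun v => ?_, fun u v => ?_, fun v => ?_, fun U hU => ?_⟩
  · rw [hxy, hxy, hx.symm u v, hy.symm u v]
  · rw [hxy, hx.diag, hy.diag]; ring
  · rw [hxy]; exact add_nonneg (mul_nonneg ha (hx.nonneg u v)) (mul_nonneg hb (hy.nonneg u v))
  · simp_rw [hxy, Finset.sum_add_distrib, ← Finset.mul_sum, hx.row, hy.row]; linarith
  · have : cut (a • x + b • y) U = a * cut x U + b * cut y U := by
      unfold cut
      simp_rw [hxy, Finset.sum_add_distrib, Finset.mul_sum]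
    rw [this]
    have h1 := hx.oddCut U hU
    have h2 := hy.oddCut U hU
    nlinarith

/-- The set of convex combinations of perfect matchings is closed (continuous image of the compact
simplex of weight functions). [cite: KorteVygen2018, Thm. 11.15 (p. 297)] -/
theorem isClosed_setOf_isPMConv : IsClosed {x : W → W → ℝ | IsPMConv x} := by
  classical
  -- the simplex of admissible weights
  set S : Set ((W → W) → ℝ) := {wt | (∀ σ, 0 ≤ wt σ) ∧ (∀ σ, wt σ ≠ 0 → IsPM σ) ∧ ∑ σ, wt σ = 1}
    with hS
  set Φ : ((W → W) → ℝ) → (W → W → ℝ) := fun wt u v => ∑ σ, wt σ * pmInd σ u v with hΦ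
  have hΦc : Continuous Φ := by
    refine continuous_pi fun u => continuous_pi fun v => ?_
    exact continuous_finsetSum _ fun σ _ => (continuous_apply σ).mul continuous_const
  have hSc : IsCompact S := by
    have hsub : S ⊆ Set.Icc 0 1 := by
      intro wt hwt
      refine ⟨fun σ => hwt.1 σ, fun σ => ?_⟩
      rw [Pi.one_apply, ← hwt.2.2]
      exact Finset.single_le_sum (f := wt) (fun τ _ => hwt.1 τ) (Finset.mem_univ σ)
    refine isCompact_Icc.of_isClosed_subset ?_ hsub
    have e : S = (⋂ σ, {wt : (W → W) → ℝ | 0 ≤ wt σ}) ∩ (⋂ σ, {wt : (W → W) → ℝ | wt σ ≠ 0 → IsPM σ}) ∩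
        {wt | ∑ σ, wt σ = 1} := by
      ext wt
      simp only [S, Set.mem_inter_iff, Set.mem_iInter, Set.mem_setOf_eq, and_assoc]
    rw [e]
    refine IsClosed.inter (IsClosed.inter ?_ ?_) ?_
    · exact isClosed_iInter fun σ => isClosed_le continuous_const (continuous_apply σ)
    · refine isClosed_iInter fun σ => ?_
      by_cases h : IsPM σ
      · have : {wt : (W → W) → ℝ | wt σ ≠ 0 → IsPM σ} = Set.univ := by ext wt; simp [h]
        rw [this]; exact isClosed_univ
      · have : {wt : (W → W) → ℝ | wt σ ≠ 0 → IsPM σ} = {wt | wt σ = 0} := by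
          ext wt; simp only [Set.mem_setOf_eq]; tauto
        rw [this]; exact isClosed_eq (continuous_apply σ) continuous_const
    · exact isClosed_eq (continuous_finsetSum _ fun σ _ => continuous_apply σ) continuous_const
  have e : {x : W → W → ℝ | IsPMConv x} = Φ '' S := by
    ext x
    simp only [Set.mem_setOf_eq, Set.mem_image]
    constructor
    · rintro ⟨wt, h1, h2, h3, h4⟩
      exact ⟨wt, ⟨h1, h2, h3⟩, by funext u v; simp only [Φ]; rw [h4]⟩
    · rintro ⟨wt, ⟨h1, h2, h3⟩, rfl⟩
      exact ⟨wt, h1, h2, h3, fun u v => rfl⟩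
  rw [e]
  exact (hSc.image hΦc).isClosed

/-- The set of convex combinations of perfect matchings is convex. [cite: KorteVygen2018, Thm. 11.15 (p. 297)] -/
theorem convex_setOf_isPMConv : Convex ℝ {x : W → W → ℝ | IsPMConv x} := by
  rintro x ⟨wx, hx1, hx2, hx3, hx4⟩ y ⟨wy, hy1, hy2, hy3, hy4⟩ a b ha hb hab
  refine ⟨fun σ => a * wx σ + b * wy σ, fun σ => add_nonneg (mul_nonneg ha (hx1 σ))
    (mul_nonneg hb (hy1 σ)), fun σ hσ => ?_, ?_, fun u v => ?_⟩
  · by_cases h : wx σ = 0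
    · have : wy σ ≠ 0 := fun h' => hσ (by dsimp only; rw [h, h']; ring)
      exact hy2 σ this
    · exact hx2 σ h
  · rw [Finset.sum_add_distrib, ← Finset.mul_sum, ← Finset.mul_sum, hx3, hy3, mul_one, mul_one, hab]
  · simp only [Pi.add_apply, Pi.smul_apply, smul_eq_mul]
    rw [hx4, hy4, Finset.mul_sum, Finset.mul_sum, ← Finset.sum_add_distrib]
    exact Finset.sum_congr rfl fun σ _ => by ring

/-- The induction over the number of vertices (universe-polymorphic in the vertex type, since the
contractions live in `Option ↥T`). [cite: KorteVygen2018, Thm. 11.15 (p. 297)] -/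
theorem isPMConv_of_isOddCutPoint_card (n : ℕ) :
    ∀ {V : Type u} [Fintype V] [DecidableEq V], Fintype.card V = n →
      ∀ x : V → V → ℝ, IsOddCutPoint x → IsPMConv x := by
  induction n using Nat.strong_induction_on with
  | _ n ih =>
  intro V _ _ hcard x hx
  classical
  -- extreme points are convex combinations of perfect matchings
  have hext : (oddCutPolytope V).extremePoints ℝ ⊆ {y | IsPMConv y} := by
    intro y hy
    have hyQ : IsOddCutPoint y := hy.1
    by_cases htight : ∃ U : Finset V, Odd U.card ∧ 3 ≤ U.card ∧ 3 ≤ Uᶜ.card ∧ cut y U = 1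
    · obtain ⟨U, hU, h3, h3c, ht⟩ := htight
      have hsum : U.card + Uᶜ.card = n := by rw [Finset.card_add_card_compl, hcard]
      have h₁ : IsPMConv (contract y Uᶜ) := by
        refine ih _ (by rw [card_option_coe]; omega) rfl _ (hyQ.contract Uᶜ ?_ ?_)
        · rwa [compl_compl]
        · rwa [compl_compl]
      have h₂ : IsPMConv (contract y U) := by
        refine ih _ (by rw [card_option_coe]; omega) rfl _
          (hyQ.contract U (hyQ.odd_compl hU) ?_)
        rw [cut_compl hyQ.symm]; exact ht
      exact isPMConv_of_contract hyQ.symm hyQ.nonneg hyQ.row (by rw [compl_compl])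
        (Finset.card_pos.mp (by omega)) h₁ h₂
    · push Not at htight
      have hstrict : ∀ U : Finset V, Odd U.card → 3 ≤ U.card → 3 ≤ Uᶜ.card → 1 < cut y U :=
        fun U hU h3 h3c => lt_of_le_of_ne (hyQ.oddCut U hU) (Ne.symm (htight U hU h3 h3c))
      obtain ⟨σ, hσ, rfl⟩ := exists_isPM_eq_pmInd_of_extreme hy hstrict
      exact hσ.isPMConv
  -- Minkowski / Krein–Milman
  have hKM := closure_convexHull_extremePoints (isCompact_oddCutPolytope (W := V))
    convex_oddCutPolytope
  have hxQ : x ∈ oddCutPolytope V := hx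
  rw [← hKM] at hxQ
  have hsub : closure (convexHull ℝ ((oddCutPolytope V).extremePoints ℝ)) ⊆ {y | IsPMConv y} := by
    rw [← isClosed_setOf_isPMConv.closure_eq]
    exact closure_mono (convexHull_min hext convex_setOf_isPMConv)
  exact hsub hxQ

/-- **Edmonds' perfect matching polytope theorem** (complete graph on a finite vertex set, real edge
weights, symmetric-function form): a symmetric nonnegative `x` with zero diagonal, unit row sums
`x(δ(v)) = 1` and `x(δ(U)) ≥ 1` for every odd `U` is a convex combination of perfect matchings.
Weights supported on the edge set of a graph `G` give the theorem for `G` (the matchings of positive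
weight use only edges of positive weight), see `EdmondsMatchingPolytope.lean`.
[cite: Edmonds1965, §2 Thm. (P) (p. 126), perfect-matching form] [cite: KorteVygen2018, Thm. 11.15 (p. 297)] -/
theorem IsOddCutPoint.isPMConv {x : W → W → ℝ} (hx : IsOddCutPoint x) : IsPMConv x :=
  isPMConv_of_isOddCutPoint_card (Fintype.card W) rfl x hx

/-- **Edmonds' theorem as an equivalence**: Edmonds' description = the convex combinations of perfect
matchings. [cite: Edmonds1965, §2 Thm. (P) (p. 126), perfect-matching form] [cite: KorteVygen2018, Thm. 11.15 (p. 297)] -/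
theorem isOddCutPoint_iff_isPMConv (x : W → W → ℝ) : IsOddCutPoint x ↔ IsPMConv x :=
  ⟨IsOddCutPoint.isPMConv, IsPMConv.isOddCutPoint⟩

/-- In a convex combination of perfect matchings, every matching of positive weight is supported on
the support of the point. [cite: KorteVygen2018, Thm. 11.15 (p. 297)] -/
theorem IsPMConv.support {x : W → W → ℝ} {wt : (W → W) → ℝ} (hw : ∀ σ, 0 ≤ wt σ)
    (hrep : ∀ u v, x u v = ∑ σ, wt σ * pmInd σ u v) {σ : W → W} (hσ : wt σ ≠ 0) (u : W) :
    0 < x u (σ u) := by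
  rw [hrep]
  have hpos : 0 < wt σ := lt_of_le_of_ne (hw σ) (Ne.symm hσ)
  calc (0 : ℝ) < wt σ * pmInd σ u (σ u) := by simp [pmInd, hpos]
    _ ≤ ∑ τ, wt τ * pmInd τ u (σ u) :=
      Finset.single_le_sum (f := fun τ => wt τ * pmInd τ u (σ u))
        (fun τ _ => mul_nonneg (hw τ) (pmInd_nonneg _ _ _)) (Finset.mem_univ σ)

end PerfectMatchingPolytope

end Literature.Combinatorics.Optimization
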